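import Mathlib
import Summits.KontsevichZagierPeriods.KontsevichZagierPeriods.Theorems.SoloInformedKZStokesCube
import Literature.NumberTheory.Transcendental.KZRulesAssociator
import HarnessLib

/-!
# SoloInformed — KZ–Stokes on the cube with LINE derivatives (toolkit for (HT))

File I2′ of the (HT) step of the solo-informed programme.  `soloInformed_kzStokes_cube` shows that
Ayoub's Stokes generator `[∂ᵢg] − [g|_{zᵢ=1}] + [g|_{zᵢ=0}]` on `[0,1]ᵐ⁺¹` is a Kontsevich–Zagier
relation for `g` `ℚ`-semialgebraic and **`C¹`** on an open `W ⊇ [0,1]ᵐ⁺¹`.  The Newton–Leibniz move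
only ever differentiates `g` along the coordinate `zᵢ`, so the same holds when `g` is merely
continuous and semialgebraic on `W` with a *partial* derivative `g′ = ∂ᵢg` (a line derivative along
`eᵢ` at every point of `W`) which is continuous on the cube (`soloInformed_kzStokes_cube_line`);
`g′` is then automatically `ℚ`-semialgebraic [Basu–Pollack–Roy 2006, Prop. 3.22]
(`Literature…IsSemialgebraicFunOn.of_hasLineDerivAt`).  Consequence: **Green's theorem on the
square inside the KZ calculus for forms `P ds + Q dt` with `P` differentiable in `t` only and `Q`
in `s` only** (`soloInformed_kzGreen_line`).  This is the regularity produced by pulling a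
holomorphic 1-form back along a Coons patch spanned by `C¹` Nash edge curves, which is how the
homotopy invariance (HT) of `κ̃` is proved.

References: Kontsevich–Zagier 2001, §1.2; Ayoub 2014, §2.2; Basu–Pollack–Roy 2006, §3.5.
-/

noncomputable section

open scoped Topology
open Set MeasureTheory Filter
open Literature.NumberTheory.Transcendental Literature.NumberTheory.Transcendental.KZ
open Literature.ModelTheory.ExponentialFields (IsSemialgebraic)

namespace Summit.KontsevichZagierPeriods.KontsevichZagierPeriods.Theorems

/-- Moving along the inserted coordinate: `insertNth i u s = insertNth i t s + (u − t)·eᵢ`. -/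
theorem soloInformed_insertNth_eq_add_smul {m : ℕ} (i : Fin (m + 1)) (s : Fin m → ℝ) (t u : ℝ) :
    (Fin.insertNth i u s : Fin (m + 1) → ℝ) =
      Fin.insertNth i t s + (u - t) • (Pi.single i 1 : Fin (m + 1) → ℝ) := by
  ext j
  refine Fin.succAboveCases i ?_ (fun j => ?_) j
  · simp [Fin.insertNth_apply_same]
  · simp [Fin.insertNth_apply_succAbove, Fin.succAbove_ne]

/-- **A partial derivative of a semialgebraic function on an open set is semialgebraic**
(line-derivative form of `IsSemialgebraicFunOn.fderiv_apply_single`).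
[Basu–Pollack–Roy 2006, Prop. 3.22] -/
theorem soloInformed_sa_lineDeriv {d : ℕ} {W : Set (Fin d → ℝ)} (hW : IsOpen W)
    {g g' : (Fin d → ℝ) → ℝ} (hgs : IsSemialgebraicFunOn ℚ W g) (i : Fin d)
    (hderiv : ∀ z ∈ W, HasLineDerivAt ℝ g (g' z) z (Pi.single i 1)) :
    IsSemialgebraicFunOn ℚ W g' := by
  refine IsSemialgebraicFunOn.of_hasLineDerivAt i hgs
    (IsSemialgebraicFunOn.isSemialgebraic_holds hgs) Subset.rfl (fun x hx => ?_) hderiv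
  have hcx : Continuous fun t : ℝ => x + t • (Pi.single i 1 : Fin d → ℝ) :=
    continuous_const.add (continuous_id.smul continuous_const)
  have h0 : x + (0 : ℝ) • (Pi.single i 1 : Fin d → ℝ) = x := by simp
  exact hcx.continuousAt.preimage_mem_nhds (by rw [h0]; exact hW.mem_nhds hx)

/-- **KZ–Stokes on the cube with a line derivative.**  `g` continuous and `ℚ`-semialgebraic on an
open `W ⊇ [0,1]ᵐ⁺¹` with partial derivative `g′` along `eᵢ` at every point of `W`, `g′` continuous
on the cube; `rD = [[0,1]ᵐ⁺¹, g′]`, `rT = [[0,1]ᵐ, g(insertNth i 1 ·)]`, `rB = [[0,1]ᵐ, g(insertNth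
i 0 ·)]`.  Then `[rD] − ([rT] − [rB]) ∈ KZ.relations`. [Ayoub 2014, §2.2; KZ 2001, §1.2] -/
theorem soloInformed_kzStokes_cube_line {m : ℕ} {W : Set (Fin (m + 1) → ℝ)} (hW : IsOpen W)
    (hCW : soloInformedCube (m + 1) ⊆ W) {g g' : (Fin (m + 1) → ℝ) → ℝ}
    (hgs : IsSemialgebraicFunOn ℚ W g) (hc : ContinuousOn g W) (i : Fin (m + 1))
    (hderiv : ∀ z ∈ W, HasLineDerivAt ℝ g (g' z) z (Pi.single i 1))
    (hDc : ContinuousOn g' (soloInformedCube (m + 1)))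
    (rD : IntegralRep (m + 1)) (hDd : rD.domain = soloInformedCube (m + 1))
    (hDi : EqOn rD.integrand g' (soloInformedCube (m + 1)))
    (rT rB : IntegralRep m) (hTd : rT.domain = soloInformedCube m)
    (hBd : rB.domain = soloInformedCube m)
    (hTi : EqOn rT.integrand (fun s => g (Fin.insertNth i 1 s)) (soloInformedCube m))
    (hBi : EqOn rB.integrand (fun s => g (Fin.insertNth i 0 s)) (soloInformedCube m)) :
    of rD - (of rT - of rB) ∈ relations := by
  have hC := isSemialgebraic_soloInformedCube (m + 1)
  have hC' := isSemialgebraic_soloInformedCube m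
  have hgsC : IsSemialgebraicFunOn ℚ (soloInformedCube (m + 1)) g := hgs.mono hCW hC
  have hDs : IsSemialgebraicFunOn ℚ (soloInformedCube (m + 1)) g' :=
    (soloInformed_sa_lineDeriv hW hgs i hderiv).mono hCW hC
  have hPs := soloInformed_isSemialgebraicMapOn_facePerm i hC
  have hPm : MapsTo (soloInformedFacePerm i) (soloInformedCube (m + 1))
      (soloInformedCube (m + 1)) := fun z hz => soloInformedFacePerm_mem_cube i hz
  have hPc : Continuous (soloInformedFacePerm i) := (soloInformedFacePermCLM i).continuous
  have hfib : ∀ s ∈ soloInformedCube m, ∀ t ∈ Icc (0 : ℝ) 1,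
      (Fin.insertNth i t s : Fin (m + 1) → ℝ) ∈ soloInformedCube (m + 1) :=
    fun s hs t ht => soloInformed_insertNth_mem_cube i hs ht.1 ht.2
  -- facet integrands
  have hTs : IsSemialgebraicFunOn ℚ (soloInformedCube m) (fun s => g (Fin.insertNth i 1 s)) :=
    IsSemialgebraicFunOn.comp_isSemialgebraicMapOn_holds hgsC
      (soloInformed_isSemialgebraicMapOn_insertNth_one hC' i)
      fun s hs => hfib s hs 1 ⟨zero_le_one, le_rfl⟩
  have hTc : ContinuousOn (fun s => g (Fin.insertNth i 1 s)) (soloInformedCube m) :=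
    hc.comp (soloInformed_continuous_insertNth_const i 1).continuousOn
      fun s hs => hCW (hfib s hs 1 ⟨zero_le_one, le_rfl⟩)
  have hBs : IsSemialgebraicFunOn ℚ (soloInformedCube m) (fun s => g (Fin.insertNth i 0 s)) :=
    IsSemialgebraicFunOn.comp_isSemialgebraicMapOn_holds hgsC
      (soloInformed_isSemialgebraicMapOn_insertNth_zero hC' i)
      fun s hs => hfib s hs 0 ⟨le_rfl, zero_le_one⟩
  have hBc : ContinuousOn (fun s => g (Fin.insertNth i 0 s)) (soloInformedCube m) :=
    hc.comp (soloInformed_continuous_insertNth_const i 0).continuousOn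
      fun s hs => hCW (hfib s hs 0 ⟨le_rfl, zero_le_one⟩)
  -- (1) relabel coordinates
  let AP : IntegralRep (m + 1) := soloInformedCubeRep (m + 1)
    (fun z => g' (soloInformedFacePerm i z))
    (IsSemialgebraicFunOn.comp_isSemialgebraicMapOn_holds hDs hPs hPm)
    (hDc.comp hPc.continuousOn hPm)
  have h1 : of AP - of rD ∈ relations :=
    soloInformed_of_sub_of_affine_mem_relations' (soloInformedFacePermCLM i) 0 (fun z => by simp)
      (by rw [volume_soloInformedCube]; exact one_ne_zero)
      (by rw [volume_soloInformedCube]; exact ENNReal.one_ne_top) hPs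
      (soloInformedFacePerm_injective i).injOn (soloInformedFacePerm_image_cube i) AP rD rfl hDd
      fun z hz => by
        show g' (soloInformedFacePerm i z) = rD.integrand (soloInformedFacePerm i z)
        rw [hDi (soloInformedFacePerm_mem_cube i hz)]
  -- (2) Newton–Leibniz along the last coordinate
  let Base : IntegralRep m := soloInformedCubeRep m
    (fun s => g (Fin.insertNth i 1 s) - g (Fin.insertNth i 0 s))
    (IsSemialgebraicFunOn.sub_holds hTs hBs) (hTc.sub hBc)
  have h2 : of AP - of Base ∈ relations := by
    refine newtonLeibnizRel_subset_relations ⟨m, AP, Base, fun _ => 0, fun _ => 1,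
      fun z => g (soloInformedFacePerm i z), ?_, ?_, ?_, ?_, soloInformedCube_succ_eq_band m,
      ?_, ?_, ?_, rfl⟩
    · exact IsSemialgebraicFunOn.comp_isSemialgebraicMapOn_holds hgsC hPs hPm
    · exact (by simpa using isSemialgebraicFunOn_ratCast hC' 0 :
        IsSemialgebraicFunOn ℚ (soloInformedCube m) fun _ : Fin m → ℝ => (0 : ℝ))
    · exact (by simpa using isSemialgebraicFunOn_ratCast hC' 1 :
        IsSemialgebraicFunOn ℚ (soloInformedCube m) fun _ : Fin m → ℝ => (1 : ℝ))
    · exact fun _ _ => zero_le_one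
    · intro s hs
      have hs' : s ∈ soloInformedCube m := hs
      show ContinuousOn (fun t : ℝ => g (soloInformedFacePerm i (Fin.snoc s t))) (Icc 0 1)
      simp only [soloInformedFacePerm_snoc]
      exact hc.comp (soloInformed_continuous_insertNth i s).continuousOn
        fun t ht => hCW (hfib s hs' t ht)
    · intro s hs t ht
      have hs' : s ∈ soloInformedCube m := hs
      have ht' : t ∈ Ioo (0 : ℝ) 1 := ht
      have hzW : (Fin.insertNth i t s : Fin (m + 1) → ℝ) ∈ W :=
        hCW (hfib s hs' t (Ioo_subset_Icc_self ht'))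
      show HasDerivAt (fun u : ℝ => g (soloInformedFacePerm i (Fin.snoc s u)))
        (g' (soloInformedFacePerm i (Fin.snoc s t))) t
      simp only [soloInformedFacePerm_snoc]
      have hL0 : HasDerivAt
          (fun τ : ℝ => g (Fin.insertNth i t s + τ • (Pi.single i 1 : Fin (m + 1) → ℝ)))
          (g' (Fin.insertNth i t s)) 0 := hderiv _ hzW
      have hL1 : HasDerivAt
          (fun τ : ℝ => g (Fin.insertNth i t s + τ • (Pi.single i 1 : Fin (m + 1) → ℝ)))
          (g' (Fin.insertNth i t s)) (t - t) := by
        rw [sub_self]; exact hL0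
      have hL2 := HasDerivAt.comp_sub_const t t hL1
      refine hL2.congr_of_eventuallyEq (Filter.Eventually.of_forall fun u => ?_)
      show g (Fin.insertNth i u s) =
        g (Fin.insertNth i t s + (u - t) • (Pi.single i 1 : Fin (m + 1) → ℝ))
      rw [← soloInformed_insertNth_eq_add_smul]
    · intro s _
      show g (Fin.insertNth i 1 s) - g (Fin.insertNth i 0 s) =
        g (soloInformedFacePerm i (Fin.snoc s 1)) - g (soloInformedFacePerm i (Fin.snoc s 0))
      rw [soloInformedFacePerm_snoc, soloInformedFacePerm_snoc]
  -- (3) split the base integrand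
  let N : IntegralRep m :=
    soloInformedCubeRep m (fun s => -g (Fin.insertNth i 0 s)) hBs.neg hBc.neg
  have h3 : of Base - of rT - of N ∈ relations :=
    integrandAddRel_subset_relations ⟨m, Base, rT, N, by rw [hTd]; rfl, rfl, fun s hs => by
      have hs' : s ∈ soloInformedCube m := hs
      show g (Fin.insertNth i 1 s) - g (Fin.insertNth i 0 s) =
        rT.integrand s + -g (Fin.insertNth i 0 s)
      rw [hTi hs']
      ring, rfl⟩
  have h4 : of N + of rB ∈ relations :=
    of_add_of_mem_relations_of_eqOn_neg (r := N) (r' := rB) (by rw [hBd]; rfl) fun s hs => by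
      have hs' : s ∈ soloInformedCube m := hs
      rw [hBi hs']
      show g (Fin.insertNth i 0 s) = -(-g (Fin.insertNth i 0 s))
      rw [neg_neg]
  have key : of rD - (of rT - of rB) =
      -(of AP - of rD) + (of AP - of Base) + (of Base - of rT - of N) + (of N + of rB) := by abel
  rw [key]
  exact relations.add_mem (relations.add_mem (relations.add_mem (relations.neg_mem h1) h2) h3) h4


/-- **Green's theorem on `[0,1]²` inside the KZ calculus, line-derivative form.**  `P`, `Q`
continuous and `ℚ`-semialgebraic on an open `W ⊇ [0,1]²` (`s = z₀`, `t = z₁`), `P` with partial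
derivative `P_t` along `e₁` and `Q` with partial derivative `Q_s` along `e₀` on `W`, both continuous
on the square and EQUAL there (closedness).  With edge representations `rB = [P(·,0)]`,
`rT = [P(·,1)]`, `rL = [Q(0,·)]`, `rR = [Q(1,·)]` on `[0,1]`:
`[rB] + [rR] − [rT] − [rL] ∈ KZ.relations`. [Kontsevich–Zagier 2001, §1.2; Ayoub 2014, §2.2] -/
theorem soloInformed_kzGreen_line {W : Set (Fin 2 → ℝ)} (hW : IsOpen W)
    (hCW : soloInformedCube 2 ⊆ W) {P Q P_t Q_s : (Fin 2 → ℝ) → ℝ}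
    (hPs : IsSemialgebraicFunOn ℚ W P) (hQs : IsSemialgebraicFunOn ℚ W Q)
    (hPc : ContinuousOn P W) (hQc : ContinuousOn Q W)
    (hPd : ∀ z ∈ W, HasLineDerivAt ℝ P (P_t z) z (Pi.single 1 1))
    (hQd : ∀ z ∈ W, HasLineDerivAt ℝ Q (Q_s z) z (Pi.single 0 1))
    (hPtc : ContinuousOn P_t (soloInformedCube 2))
    (hclosed : EqOn P_t Q_s (soloInformedCube 2))
    (rB rT rL rR : IntegralRep 1) (hBd : rB.domain = soloInformedCube 1)
    (hTd : rT.domain = soloInformedCube 1) (hLd : rL.domain = soloInformedCube 1)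
    (hRd : rR.domain = soloInformedCube 1)
    (hBi : EqOn rB.integrand (fun s => P (Fin.insertNth 1 0 s)) (soloInformedCube 1))
    (hTi : EqOn rT.integrand (fun s => P (Fin.insertNth 1 1 s)) (soloInformedCube 1))
    (hLi : EqOn rL.integrand (fun t => Q (Fin.insertNth 0 0 t)) (soloInformedCube 1))
    (hRi : EqOn rR.integrand (fun t => Q (Fin.insertNth 0 1 t)) (soloInformedCube 1)) :
    of rB + of rR - of rT - of rL ∈ relations := by
  have hC := isSemialgebraic_soloInformedCube 2
  have hDs : IsSemialgebraicFunOn ℚ (soloInformedCube 2) P_t :=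
    (soloInformed_sa_lineDeriv hW hPs 1 hPd).mono hCW hC
  set rD : IntegralRep 2 := soloInformedCubeRep 2 _ hDs hPtc with hrD
  have hSP : of rD - (of rT - of rB) ∈ relations :=
    soloInformed_kzStokes_cube_line hW hCW hPs hPc 1 hPd hPtc rD rfl (fun _ _ => rfl) rT rB hTd
      hBd hTi hBi
  have hSQ : of rD - (of rR - of rL) ∈ relations :=
    soloInformed_kzStokes_cube_line hW hCW hQs hQc 0 hQd (hPtc.congr fun z hz => (hclosed hz).symm)
      rD rfl (fun z hz => hclosed hz) rR rL hRd hLd hRi hLi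
  have heq : of rB + of rR - of rT - of rL =
      (of rD - (of rT - of rB)) - (of rD - (of rR - of rL)) := by
    abel
  rw [heq]
  exact relations.sub_mem hSP hSQ

/-- `soloInformed_kzGreen_line` in the formal period ring: `⟦rB⟧ + ⟦rR⟧ = ⟦rT⟧ + ⟦rL⟧`. -/
theorem soloInformed_kzGreen_line_toFormalPeriod {W : Set (Fin 2 → ℝ)} (hW : IsOpen W)
    (hCW : soloInformedCube 2 ⊆ W) {P Q P_t Q_s : (Fin 2 → ℝ) → ℝ}
    (hPs : IsSemialgebraicFunOn ℚ W P) (hQs : IsSemialgebraicFunOn ℚ W Q)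
    (hPc : ContinuousOn P W) (hQc : ContinuousOn Q W)
    (hPd : ∀ z ∈ W, HasLineDerivAt ℝ P (P_t z) z (Pi.single 1 1))
    (hQd : ∀ z ∈ W, HasLineDerivAt ℝ Q (Q_s z) z (Pi.single 0 1))
    (hPtc : ContinuousOn P_t (soloInformedCube 2))
    (hclosed : EqOn P_t Q_s (soloInformedCube 2))
    (rB rT rL rR : IntegralRep 1) (hBd : rB.domain = soloInformedCube 1)
    (hTd : rT.domain = soloInformedCube 1) (hLd : rL.domain = soloInformedCube 1)
    (hRd : rR.domain = soloInformedCube 1)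
    (hBi : EqOn rB.integrand (fun s => P (Fin.insertNth 1 0 s)) (soloInformedCube 1))
    (hTi : EqOn rT.integrand (fun s => P (Fin.insertNth 1 1 s)) (soloInformedCube 1))
    (hLi : EqOn rL.integrand (fun t => Q (Fin.insertNth 0 0 t)) (soloInformedCube 1))
    (hRi : EqOn rR.integrand (fun t => Q (Fin.insertNth 0 1 t)) (soloInformedCube 1)) :
    toFormalPeriod (of rB) + toFormalPeriod (of rR) =
      toFormalPeriod (of rT) + toFormalPeriod (of rL) := by
  rw [← map_add, ← map_add, toFormalPeriod_eq_iff]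
  have heq : of rB + of rR - (of rT + of rL) = of rB + of rR - of rT - of rL := by abel
  rw [heq]
  exact soloInformed_kzGreen_line hW hCW hPs hQs hPc hQc hPd hQd hPtc hclosed rB rT rL rR hBd hTd
    hLd hRd hBi hTi hLi hRi

end Summit.KontsevichZagierPeriods.KontsevichZagierPeriods.Theorems
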